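import Summits.BirchSwinnertonDyer.Rank1Residual.Partition.MainConjectures
import Literature.NumberTheory.EllipticCurves.SkinnerUrban2014.RankZeroPPartOfMainConjectureProofs
import Literature.NumberTheory.EllipticCurves.Rank1Residual.ClassX1KellerYinCertificate
import HarnessLib

/-!
# Row C1's citation of record DERIVED: Skinner 2016 Thm. C, in its literal typed form, from the typed
# MAIN CONJECTURES (Skinner–Urban 2014 Thm. 3.6.9, Skinner 2016 Thm. A) + the typed control theorems —
# and the S–U route WITHOUT Wuthrich 2014 Lemma 20 (cell `b2b-bsdres`, GLUE seat gen 5; companion of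
# `Partition/MainConjectures.lean`)

HONEST FRAMING (cell `b2b-bsdres`, run/shared/lean/b2b/bsd-rank1-residual/, verbatim in every
file): the goal of the cell is to DELETE the COMBINATION-SHAPED residual classes of the
Birch–Swinnerton-Dyer formula for ALL analytic-rank `≤ 1` elliptic curves over `ℚ` — "full BSD
formula for every rank `≤ 1` curve in class `C`" assembled STRICTLY from published theorems — so
that the rank-`≤ 1` remainder becomes exactly the CONSTRUCTION-SHAPED classes, which are TYPED
(missing-input `Prop`s), NOT attempted. This is not "finishing BSD". Research routes; no claim
beyond the stated classes; nothing booked; no label changes. THEOREMS ONLY (no definition, no named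
fact, no `sorry`); every published theorem enters as one of the tree's existing named Literature
facts BY NAME.

## What this file records

1. **Wuthrich 2014 Lemma 20 leaves the S–U route** (the literature typer `b2b-bsdres-lit-su`, gen 5,
   `SkinnerUrban2014/RankZeroPPartOfMainConjectureProofs.lean`, p244937): on the locus of
   Skinner–Urban Thm. 3.6.11 (a) / Skinner 2016 Thm. C the hypothesis (ram) is always in scope, and
   "`ρ̄_{E,p}` onto + the inertia transvection at the (ram) prime ⟹ `ρ̄_{E,p^n}` onto for all `n`" at
   EVERY prime is the tree theorem `hasSurjectiveModNGaloisRep_pow_of_hasMultiplicativeReductionAtPrime`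
   (Serre 1972 IV §3.4 Lemma 2), so neither Serre's lifting lemma (`p ≥ 5`) nor Wuthrich's Lemma 20
   (`p = 3`, binder `hW3` of gen 0's `mazurMainConjecture_of_skinnerUrban` /
   `RowC1.bsdp_of_mainConjectures`) is needed. `Partition/MainConjectures.lean` is append-only, so the
   `hW3`-free statements are given here under new names (`…_of_ram`); the gen-0 theorems stay (they
   are the special case fed with one more fact).
2. **Row C1's citation of record is DERIVED in the kernel**: the literal named fact
   `Skinner2016.thmC_padicValRat_bsd_rank_zero` (Skinner, Pacific J. Math. 283 (2016) Thm. C — the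
   A-row behind `RowC1.bsdp` in `Partition/Bsdp.lean`) follows from the main-conjecture-level named
   facts Skinner–Urban 2014 Thm. 3.6.9 (`skinner_urban_main_conjecture`, bsd.S21, good branch) and
   Skinner 2016 Thm. A (`thmA_charIdeal_multiplicative`, multiplicative branch) + the control /
   leading-term facts (Greenberg 1999 Thm. 4.1; the Greenberg–Vatsal period unit; Jones 1989 /
   Stein–Wuthrich 2013 Thm. 6.1; Greenberg–Stevens; `𝓛_p ≠ 0` is a tree theorem) + modularity + GZK
   — `RowC1.skinnerThmC_of_mainConjectures`. This is Skinner's own proof (§3.2–3.3 / S–U p. 46) run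
   in the kernel; the same pattern as `RowC6.cgsThmD_of_display55_of_cgsThmA` (lit-cgls, A47 from
   A142 + A157). Consequence for the registry: the C1 fact can be carried as "derived from bsd.S21 +
   Skinner Thm. A + control (this file)"; for `Partition/Bsdp.lean`'s consequence form
   `bsdp_of_covered` the binder `hSk` is now dischargeable from MC-level binders.

References: [Skinner2016PacificMC] Thm. C, footnote 1, §2.5, Thm. A, §3.2–3.3; [SkinnerUrban2014]
Thm. 3.6.9 (p. 45), Thm. 3.6.11 (a) and its proof (p. 46); [Serre1972] §2.4 Prop. 15, IV §3.4
Lemma 2; [GreenbergLNM1716] Thm. 4.1; [GreenbergVatsal2000] §3 Rem. 3.4; [SteinWuthrich2013]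
Thm. 6.1; [Miller2011LMS] Def. 1.1; HOME/b2b-bsdres-lit-su/SU2014-TYPING.md §11.4 (migration recipe);
RESIDUAL-CASES.md §a.1 row C1.
-/

set_option autoImplicit false

noncomputable section

open scoped Classical MatrixGroups ModularForm

open CongruenceSubgroup WeierstrassCurve Literature.NumberTheory.EllipticCurves
  Literature.NumberTheory.EllipticCurves.ModularForms
  Literature.NumberTheory.EllipticCurves.Rank1Residual
  Literature.NumberTheory.EllipticCurves.Skinner2016
  Literature.NumberTheory.EllipticCurves.SteinWuthrich2013
  Summit.BirchSwinnertonDyer.BirchSwinnertonDyer.Theorems.Rank1ResidualX1Defs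

namespace Summit.BirchSwinnertonDyer.Rank1Residual

section Curve

variable {W : WeierstrassCurve ℚ} [W.IsElliptic] [W.IsGloballyMinimal] {p : ℕ} [Fact p.Prime]

/-! ### §1. The S–U route without Wuthrich 2014 Lemma 20 -/

/-- **Skinner–Urban 2014 Thm. 3.6.9 (integral clause) ⇒ the typed `MazurMainConjecture W p` on
{`p ≥ 3` good ordinary, (irr), (ram)} — WITHOUT Wuthrich 2014 Lemma 20.** Exactly gen 0's
`mazurMainConjecture_of_skinnerUrban` with the `p`-adic surjectivity step replaced: (irr) + (ram) ⇒
`ρ̄_{E,p}` onto (`surj_of_irr_of_ram`, Serre 1972 Prop. 15) and the (ram) prime's inertia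
transvection ⇒ `ρ̄_{E,p^n}` onto for all `n` at EVERY prime
(`hasSurjectiveModNGaloisRep_pow_of_hasMultiplicativeReductionAtPrime`, Serre 1972 IV §3.4 Lemma 2);
then S–U clauses (1), (3) (`hSU`, bsd.S21) and the Néron normalisation by the period unit (`h5`,
`h3`, Greenberg–Vatsal 2000 §3). [cite: SkinnerUrban2014, Thm. 3.6.9 (p. 45)]
[cite: Serre1972, §2.4 Prop. 15; IV §3.4 Lemma 2] [cite: GreenbergVatsal2000, §3, Remark 3.4] -/
theorem mazurMainConjecture_of_skinnerUrban_of_ram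
    (hSU : ∀ (W : WeierstrassCurve ℚ) [W.IsElliptic] [W.IsGloballyMinimal] (p : ℕ) [Fact p.Prime]
      (κ : ZpExtension ℚ p) (γ : Field.absoluteGaloisGroup ℚ) (N : ℕ) [NeZero N]
      (f : CuspForm (Gamma0 N) 2),
      skinner_urban_main_conjecture W p (κ := κ) (γ := γ) (f := f))
    (h5 : realPeriodRat_eq_unit_mul_plusPeriod) (h3 : realPeriodRat_eq_unit_mul_plusPeriod_three)
    (hp : 3 ≤ p) (hord : GoodOrd W p) (hirr : Irr W p) (hram : Ram W p) :
    MazurMainConjecture W p := by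
  intro κ γ hκ hγ hγ' _ f hf ϖ hϖ D
  have hsurj : Surj W p := surj_of_irr_of_ram W p hirr hram
  -- `p`-adic surjectivity from surj + (ram), at every prime (no Serre lifting lemma, no Wuthrich L. 20)
  have hsur : ∀ n : ℕ, W.HasSurjectiveModNGaloisRep (p ^ n : ℕ) :=
    hasSurjectiveModNGaloisRep_pow_of_hasMultiplicativeReductionAtPrime W p hsurj hram
  -- Skinner–Urban, clauses (1) and (3)
  obtain ⟨hX, -, hint⟩ := hSU W p κ γ _ f hp hord.1 hord.2 hirr hram hκ hγ hγ' hf D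
  obtain ⟨g, hιg, hchar⟩ := hint hsur
  -- the period ratio is a `p`-adic unit
  have hv : padicValRat p ϖ = 0 :=
    periodUnit_of_realPeriodRat_eq_unit_mul_plusPeriod h5 h3 W p (by omega) hord.1 hirr f hf ϖ hϖ
  have hϖ0 : ϖ ≠ 0 := by
    have hpos : 0 < plusPeriod f := IsNewform0.plusPeriod_pos_holds hf.1 hf.coeffField_eq_bot
    rintro rfl
    simp only [Rat.cast_zero, zero_mul] at hϖ
    exact absurd hϖ hpos.ne
  have hnorm : ‖((ϖ : ℚ) : ℚ_[p])‖ = 1 := by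
    rw [Padic.eq_padicNorm, padicNorm.eq_zpow_of_nonzero hϖ0, hv]
    simp
  set u : ℤ_[p] := ⟨((ϖ : ℚ) : ℚ_[p]), hnorm.le⟩ with hu
  have hunit : IsUnit u := PadicInt.isUnit_iff.mpr hnorm
  refine ⟨hX, PowerSeries.C u * g, ?_, ?_⟩
  · rw [hchar]
    exact (Ideal.span_singleton_mul_left_unit (hunit.map PowerSeries.C) g).symm
  · rw [map_mul, hιg, PowerSeries.map_C]
    rfl

/-! ### §2. Skinner 2016 Thm. C, literally, from the typed main conjectures and control theorems -/

/-- **Row C1's citation of record DERIVED: Skinner 2016 Thm. C in its LITERAL typed form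
`Skinner2016.thmC_padicValRat_bsd_rank_zero`, from the main-conjecture-level named facts and the
typed control theorems** — Skinner's printed proof (Pacific J. Math. 283 (2016) §3.2–3.3; S–U
p. 46) run in the kernel, every input an existing named fact:
* good ordinary branch — (irr) + (ram) ⇒ `ρ̄_{E,p}` onto (`surj_of_irr_of_ram`) and `ρ̄_{E,p^∞}`
  onto (the (ram) transvection, no Wuthrich L. 20) ⇒ Skinner–Urban 2014 Thm. 3.6.9 clause 3 (`hSU`,
  bsd.S21: the INTEGRAL cyclotomic main conjecture) + Greenberg 1999 Thm. 4.1 (`hGr`) + the period unit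
  `ord_p(Ω⁺_f/Ω_E) = 0` (`h5`, `h3`) + modularity with an integral Manin constant (`hpar`) ⇒ bsd.S30
  (`SkinnerUrban2014.padicValRat_bsd_rank_zero_of_mainConjecture_of_ram`), whose conclusion IS Thm. C's
  display `L(E,1)/Ω_E = q`, `ord_p q = ord_p #Ш + ord_p ∏c_ℓ − 2 ord_p #E(ℚ)_tors`;
* multiplicative branch — Skinner 2016 Thm. A (`hA`) ⇒ the typed `X2.MazurMainConjectureAt W p`
  (`X2.mazurMainConjectureAt_of_thmA`) + Jones 1989 / Stein–Wuthrich 2013 Thm. 6.1 (`hJs`, `hJn`) +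
  Greenberg–Stevens (`hGS`) + `𝓛_p ≠ 0` ⇒ `BSD(E,p)` (x11a's
  `X2.bsdp_of_mazurMainConjectureAt_of_analyticRank_eq_zero_heightFree`) ⇒ the rank-`0` print shape
  (`pPart_of_bsdp`, `pPartRankZero_of_pPart`: Miller's `BSD(E,p)` back to the display; `hmod`, `hGZK`).
The fact's own `L(E,1) ≠ 0` is read as `r_an = 0` by modularity; its `Finite Ш` binder feeds bsd.S30 on
the good branch and is idle on the multiplicative one (GZK). [cite: Skinner2016PacificMC, Thm. C, footnote 1, §2.5, Thm. A, §3.2–3.3]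
[cite: SkinnerUrban2014, Thm. 3.6.9 (p. 45), proof of Thm. 3.6.11 (p. 46)]
[cite: GreenbergLNM1716, Thm. 4.1 (p. 102)] [cite: SteinWuthrich2013, Thm. 6.1 (p. 20)]
[cite: GreenbergVatsal2000, §3, Remark 3.4] [cite: Miller2011LMS, §1 and Def. 1.1] -/
theorem RowC1.skinnerThmC_of_mainConjectures
    (hSU : ∀ (W : WeierstrassCurve ℚ) [W.IsElliptic] [W.IsGloballyMinimal] (p : ℕ) [Fact p.Prime]
      (κ : ZpExtension ℚ p) (γ : Field.absoluteGaloisGroup ℚ) (N : ℕ) [NeZero N]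
      (f : CuspForm (Gamma0 N) 2),
      skinner_urban_main_conjecture W p (κ := κ) (γ := γ) (f := f))
    (hA : thmA_charIdeal_multiplicative) (hGr : greenberg_charValue_rankZero)
    (hJs : thm61_splitMultiplicative) (hJn : thm61_nonsplitMultiplicative)
    (hGS : ∀ (W : WeierstrassCurve ℚ) [W.IsElliptic] [W.IsGloballyMinimal] (p : ℕ) [Fact p.Prime],
      greenberg_stevens (W := W) (p := p))
    (h5 : realPeriodRat_eq_unit_mul_plusPeriod) (h3 : realPeriodRat_eq_unit_mul_plusPeriod_three)
    (hmod : hasEntireLFunction_rat) (hpar : nonempty_modularParametrizationData)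
    (hGZK : rank_eq_analyticRank_of_analyticRank_le_one) :
    Skinner2016.thmC_padicValRat_bsd_rank_zero := by
  intro W _ _ p _ hp hred hirr hram hL hfin
  have hr0 : W.analyticRank = 0 := (W.analyticRank_eq_zero_iff_holds (hmod W)).mpr hL
  rcases hred with ⟨hgood, hord⟩ | hmult
  · -- good ordinary: bsd.S21 (integral, via surj + (ram)) ⇒ bsd.S30 = the display of Thm. C
    have hS30 : padicValRat_bsd_rank_zero :=
      SkinnerUrban2014.padicValRat_bsd_rank_zero_of_mainConjecture_of_ram hpar hSU hGr
        (periodUnit_of_realPeriodRat_eq_unit_mul_plusPeriod h5 h3)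
    exact hS30 W p hp hgood hord hirr hram hL (surj_of_irr_of_ram W p hirr hram) hfin
  · -- multiplicative: Skinner Thm. A ⇒ the typed main conjecture at `p ‖ N` ⇒ BSD(E,p) ⇒ the display
    have hB : BSDp W p :=
      X2.bsdp_of_mazurMainConjectureAt_of_analyticRank_eq_zero_heightFree hJs hJn hGZK hmod hpar W p
        (hGS W p) (by omega) hmult hr0 (X2.mazurMainConjectureAt_of_thmA hA hp hmult hirr hram)
    exact pPartRankZero_of_pPart hGZK W p hr0 (pPart_of_bsdp hmod hGZK W p (by omega) hB)

/-- **C1 at main-conjecture level WITHOUT Wuthrich 2014 Lemma 20**: gen 0's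
`RowC1.bsdp_of_mainConjectures` minus the binder `hW3` — through the derived Thm. C
(`RowC1.skinnerThmC_of_mainConjectures`) and `Partition/Bsdp.lean`'s `RowC1.bsdp`.
[cite: Skinner2016PacificMC, Thm. C, Thm. A, §3.2–3.3] [cite: SkinnerUrban2014, Thm. 3.6.9 (p. 45)]
[cite: Miller2011LMS, Def. 1.1] -/
theorem RowC1.bsdp_of_mainConjectures_of_ram
    (hSU : ∀ (W : WeierstrassCurve ℚ) [W.IsElliptic] [W.IsGloballyMinimal] (p : ℕ) [Fact p.Prime]
      (κ : ZpExtension ℚ p) (γ : Field.absoluteGaloisGroup ℚ) (N : ℕ) [NeZero N]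
      (f : CuspForm (Gamma0 N) 2),
      skinner_urban_main_conjecture W p (κ := κ) (γ := γ) (f := f))
    (hA : thmA_charIdeal_multiplicative) (hGr : greenberg_charValue_rankZero)
    (hJs : thm61_splitMultiplicative) (hJn : thm61_nonsplitMultiplicative)
    (hGS : ∀ (W : WeierstrassCurve ℚ) [W.IsElliptic] [W.IsGloballyMinimal] (p : ℕ) [Fact p.Prime],
      greenberg_stevens (W := W) (p := p))
    (h5 : realPeriodRat_eq_unit_mul_plusPeriod) (h3 : realPeriodRat_eq_unit_mul_plusPeriod_three)
    (hmod : hasEntireLFunction_rat) (hpar : nonempty_modularParametrizationData)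
    (hGZK : rank_eq_analyticRank_of_analyticRank_le_one) (h : RowC1 W p) : BSDp W p :=
  RowC1.bsdp (RowC1.skinnerThmC_of_mainConjectures hSU hA hGr hJs hJn hGS h5 h3 hmod hpar hGZK) hmod
    hGZK h

end Curve

end Summit.BirchSwinnertonDyer.Rank1Residual

end
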